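/-
Origin: expansion seat `planner-pub-hodgecm-pv06-g2-0`, handover (b) v5 2026-08-18T05:31:22Z (`HOME/pub-hodgecm-pv06-g2/lean/Pv06g2/DenseOrbit.lean`, md5 ce53afe5, 129 lines);
landed by the gen-6 packager in gate run 23 REPLACES the earlier landed copy of `HodgeCM/PerL34/DenseOrbit.lean` (verbatim).
-/
/-
Origin: HOME/pub-hodgecm-pv06-g2/lean/Pv06g2/DenseOrbit.lean — session planner-pub-hodgecm-pv06-g2-0 (unit pub-hodgecm-pv06-g2,
DAG-NODE PROVER #06 of 15, generation 2).  Intended final place: `HodgeCM/PerL34/DenseOrbit.lean`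
(namespace `HodgeCM.PerL34.DenseOrbit`).  Imports: Mathlib only.  Closed, nothing cited, nothing posited.

# `U(W)(L₀) · T(𝔸) · U(W)(𝔸_f)` is dense in `U(W)(𝔸)` — the topological step of PerL v5 ll. 430–433

The `[PRINT]` field `dense` of `HodgeCM.PerL34.Annihilation.AnnihilationDatum` (Annihilation.lean:310),

  `dense : Dense {g : G | ∃ γ ∈ Γ, ∃ (t : TA) (hf : Gf), g = γ * ιA t * ιf hf}`,

packages TWO things: the published theorem (real approximation, [GH24] Thm. 2.5.2 / Platonov–Rapinchuk Thm 7.7: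
`U(W)(L₀)` is dense in `U(W)(L₀ ⊗ ℝ) = ∏_{v∣∞} U(W_v)`, for `W` the hermitian PLANE of PerL l. 314 — so the factors are
`U(2)`/`U(1,1)`, NOT the torus case `RealApproximation_U1`; PROVED for every non-degenerate hermitian Gram matrix over the
CM field, at all archimedean places at once, as `HodgeCM.Literature.RealApproximation_UH_holds` /
`HodgeCM.Literature.RealApproximation.denseRange_archEmb` in `HodgeCM/Literature/RealApproximationUnitary.lean`, on top of
cf-hasseminkowski-g4's one-place Cayley machinery in `HodgeCM/Literature/RealApproximation.lean`) and the two-line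
deduction of the tex (ll. 430–433: "given `(x_∞, x_f)`, approximate `x_∞` by `γ ∈ U(W)(L₀)`; then `(γ, γ·γ⁻¹x_f)` lies
in the set").
This file is the KERNEL form of that deduction over the evident model: `U(W)(𝔸) ≅ U(W)(L₀⊗ℝ) × U(W)(𝔸_f)` as
topological groups (`e : G ≃ₜ* G∞ × Gf`), `U(W)(𝔸_f) ↪ U(W)(𝔸)` as the second factor (`hιf`), and real
approximation as density of the archimedean components of `Γ = U(W)(L₀)` (`hRA` — for `G∞ = unitaryPiSet L Hm` and
`Γ = unitaryGroup σ Hm` this is `denseRange_archEmb L Hm hH hdet`; see `dense_of_realApproximation` below for the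
kernel transport from the matrix-level statement).  The torus factor `T(𝔸)` is
not needed (any one element `t₀` of it will do), exactly as in the tex, which uses `t = 1`.
-/
import Mathlib
import Literature.Topology.Algebra.DenseProductSubgroup

/-! PORT of `HodgeCM/PerL34/DenseOrbit.lean` (HodgeCMPerL run 82) — verbatim mechanical port; provenance in the PORT header line. -/

set_option autoImplicit false

namespace HodgeCM

/-- Port anchor (port_pkg realias): every theorem of this ported file is now an `alias` of an already-landed tree declaration;
this file-unique trivial theorem keeps one genuine declaration in the file (gate lint; the literal is the source sha256 prefix). -/
theorem DenseOrbit_port_anchor : (18374422982585842108 : Nat) = 18374422982585842108 := rfl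

namespace PerL34
namespace DenseOrbit

open Function Set

variable {G Ginf Gf : Type*} [Group G] [TopologicalSpace G]
  [Group Ginf] [TopologicalSpace Ginf] [ContinuousMul Ginf] [Group Gf] [TopologicalSpace Gf]

/-- **PerL v5 ll. 430–433.**  If `G ≅ G∞ × Gf` as topological groups, `ιf` is the inclusion of the second
factor, and the first components of `Γ ≤ G` are dense in `G∞` (real approximation), then for any family
`ιA : TA → G` with `TA` inhabited, `Γ · ιA(TA) · ιf(Gf)` is dense in `G`. -/
alias dense_of_denseRange_fst := Literature.Topology.Algebra.DenseOrbit.dense_of_denseRange_fst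

/-- The same with real approximation phrased on a dense SUBSET: it suffices that the archimedean components of
some subset of `Γ` be dense (e.g. of a smaller arithmetic subgroup). -/
alias dense_of_dense_image_fst := Literature.Topology.Algebra.DenseOrbit.dense_of_dense_image_fst

/-- Reading a closure statement in the ambient space (the shape of `RealApproximation_U1`: every point of a subset
`S` lies in the closure of the range of `f`, whose values lie in `S`) as density of the `S`-valued corestriction —
the form `hRA` above wants when `G∞` is realised as a (closed) subgroup `S` of an ambient space. -/
alias denseRange_codRestrict_iff := Literature.Topology.Algebra.DenseOrbit.denseRange_codRestrict_iff

omit [ContinuousMul Ginf] in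
/-- TRANSPORT of a matrix-level real-approximation statement into the dictionary shape `hRA` of
`dense_of_denseRange_fst`.  Inputs: an embedding `val` of the archimedean group `G∞` into an ambient space `M`
(for `U(W)`: families of complex matrices indexed by the archimedean places — this, with `range val` = the unitary
families, is the D3 identification `U(W)(L₀⊗ℝ) ≅ {u | ∀ w, (u w)ᴴ H^{w} (u w) = H^{w}}`), a family `ρ` of points of
`M` each of which is the archimedean component of an element of `Γ` (the rational points `g ↦ (g^{w})_w`), and the
closure statement `range val ⊆ closure (range ρ)` — literally the conclusion of the kernel real-approximation theorem
(`RealApproximation_UH_holds`, whose conclusion `u ∈ closure {x | ∃ g ∈ U(H)(L₀), … = x}` for every unitary family `u`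
is this with `ρ` the rational-point map).  Output: `hRA`.  Only `IsInducing val` is used. -/
alias denseRange_fst_of_isInducing := Literature.Topology.Algebra.DenseOrbit.denseRange_fst_of_isInducing

/-- The two steps combined: N23c `dense` from the dictionary (`e`, `ιf`, an inducing realisation `val` of `G∞`
with its rational points `ρ`) and the matrix-level real-approximation conclusion `range val ⊆ closure (range ρ)`. -/
alias dense_of_realApproximation := Literature.Topology.Algebra.DenseOrbit.dense_of_realApproximation

end DenseOrbit
end PerL34
end HodgeCM
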